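import Summits.CriticalPhenomena.PercolationContinuityZ3.Theorems.PercNearOneGluingNoHeavyLowerTailSwitchRelaxGR3Measure
import HarnessLib

/-!
# Four-point cell dictionary for the INCREASING cubic rows certified by clean switching certificates (prim-masterthm-p1 gen 2)

Support file (`--supports stmt-CriticalPhenomena-4575`).  No named facts, no sorries.  Each lemma writes the `prodBernoulli w`-measure of an
event built from `openConn` by unions/intersections (an increasing 4-point letter `U[X|Y]` or an intersection of such) as the explicit sum of
the cells `FourPointAtoms.cell w a b c y i` it consists of (`measureReal_eq_cellSum` + `decide` on the 15 patterns).  Shared by the measure-level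
theorem files `…SwitchRelaxFinc*Measure`.
-/

noncomputable section

namespace Summit.CriticalPhenomena.PercolationContinuityZ3.Theorems

namespace SwitchRelax

namespace IncDict

open MeasureTheory Set Literature.Probability.Percolation Literature.Probability.LatticeModels FourPointAtoms
open Summit.CriticalPhenomena.PercolationContinuityZ3.Cruxes.AdditiveGluing.TieLine.ConnAtoms
open scoped Classical

variable {V : Type*} [Fintype V] (w : Sym2 V → unitInterval) (a b c y : V)

/-- Dictionary entry: the event `(openConn a c ∪ openConn b c) ∩ (openConn a y ∪ openConn b y)` as a sum of four-point cells. [this work] -/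
theorem d45 : (prodBernoulli w).real ((openConn a c ∪ openConn b c) ∩ (openConn a y ∪ openConn b y)) =
    cell w a b c y 7 + cell w a b c y 8 + cell w a b c y 9 + cell w a b c y 10 + cell w a b c y 14 := by
  rw [measureReal_eq_cellSum w a b c y (show HasPattern (quad a b c y) ((openConn a c ∪ openConn b c) ∩ (openConn a y ∪ openConn b y)) _ from
    ((((oc a b c y 0 2 rfl rfl)).union (oc a b c y 1 2 rfl rfl))).inter (((oc a b c y 0 3 rfl rfl)).union (oc a b c y 1 3 rfl rfl)))]
  simp (config := {decide := true}) only [ite_true, ite_false]; ring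

/-- Dictionary entry: the event `(openConn a c ∪ openConn b c) ∩ (openConn a b ∪ openConn a y ∪ openConn c b ∪ openConn c y) ∩ (openC` as a sum of four-point cells. [this work] -/
theorem d46 : (prodBernoulli w).real ((openConn a c ∪ openConn b c) ∩ (openConn a b ∪ openConn a y ∪ openConn c b ∪ openConn c y) ∩ (openConn b c ∪ openConn b y)) =
    cell w a b c y 3 + cell w a b c y 7 + cell w a b c y 8 + cell w a b c y 13 + cell w a b c y 14 := by
  rw [measureReal_eq_cellSum w a b c y (show HasPattern (quad a b c y) ((openConn a c ∪ openConn b c) ∩ (openConn a b ∪ openConn a y ∪ openConn c b ∪ openConn c y) ∩ (openConn b c ∪ openConn b y)) _ from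
    (((((oc a b c y 0 2 rfl rfl)).union (oc a b c y 1 2 rfl rfl))).inter (((((((oc a b c y 0 1 rfl rfl)).union (oc a b c y 0 3 rfl rfl))).union (oc a b c y 2 1 rfl rfl))).union (oc a b c y 2 3 rfl rfl))).inter (((oc a b c y 1 2 rfl rfl)).union (oc a b c y 1 3 rfl rfl)))]
  simp (config := {decide := true}) only [ite_true, ite_false]; ring

/-- Dictionary entry: the event `(openConn a b ∪ openConn a y ∪ openConn c b ∪ openConn c y) ∩ (openConn b c ∪ openConn b y)` as a sum of four-point cells. [this work] -/
theorem d47 : (prodBernoulli w).real ((openConn a b ∪ openConn a y ∪ openConn c b ∪ openConn c y) ∩ (openConn b c ∪ openConn b y)) =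
    cell w a b c y 3 + cell w a b c y 7 + cell w a b c y 8 + cell w a b c y 12 + cell w a b c y 13 + cell w a b c y 14 := by
  rw [measureReal_eq_cellSum w a b c y (show HasPattern (quad a b c y) ((openConn a b ∪ openConn a y ∪ openConn c b ∪ openConn c y) ∩ (openConn b c ∪ openConn b y)) _ from
    ((((((((oc a b c y 0 1 rfl rfl)).union (oc a b c y 0 3 rfl rfl))).union (oc a b c y 2 1 rfl rfl))).union (oc a b c y 2 3 rfl rfl))).inter (((oc a b c y 1 2 rfl rfl)).union (oc a b c y 1 3 rfl rfl)))]
  simp (config := {decide := true}) only [ite_true, ite_false]; ring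

/-- Dictionary entry: the event `(openConn a c ∪ openConn b c) ∩ (openConn b c ∪ openConn b y)` as a sum of four-point cells. [this work] -/
theorem d48 : (prodBernoulli w).real ((openConn a c ∪ openConn b c) ∩ (openConn b c ∪ openConn b y)) =
    cell w a b c y 3 + cell w a b c y 7 + cell w a b c y 8 + cell w a b c y 9 + cell w a b c y 13 + cell w a b c y 14 := by
  rw [measureReal_eq_cellSum w a b c y (show HasPattern (quad a b c y) ((openConn a c ∪ openConn b c) ∩ (openConn b c ∪ openConn b y)) _ from
    ((((oc a b c y 0 2 rfl rfl)).union (oc a b c y 1 2 rfl rfl))).inter (((oc a b c y 1 2 rfl rfl)).union (oc a b c y 1 3 rfl rfl)))]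
  simp (config := {decide := true}) only [ite_true, ite_false]; ring

/-- Dictionary entry: the event `(openConn b y ∪ openConn c y)` as a sum of four-point cells. [this work] -/
theorem d49 : (prodBernoulli w).real ((openConn b y ∪ openConn c y)) =
    cell w a b c y 1 + cell w a b c y 2 + cell w a b c y 7 + cell w a b c y 9 + cell w a b c y 10 + cell w a b c y 11 + cell w a b c y 12 + cell w a b c y 14 := by
  rw [measureReal_eq_cellSum w a b c y (show HasPattern (quad a b c y) ((openConn b y ∪ openConn c y)) _ from
    (((oc a b c y 1 3 rfl rfl)).union (oc a b c y 2 3 rfl rfl)))]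
  simp (config := {decide := true}) only [ite_true, ite_false]; ring

/-- Dictionary entry: the event `(openConn a c ∪ openConn b c) ∩ (openConn a y ∪ openConn c y) ∩ (openConn b y ∪ openConn c y)` as a sum of four-point cells. [this work] -/
theorem d50 : (prodBernoulli w).real ((openConn a c ∪ openConn b c) ∩ (openConn a y ∪ openConn c y) ∩ (openConn b y ∪ openConn c y)) =
    cell w a b c y 7 + cell w a b c y 10 + cell w a b c y 14 := by
  rw [measureReal_eq_cellSum w a b c y (show HasPattern (quad a b c y) ((openConn a c ∪ openConn b c) ∩ (openConn a y ∪ openConn c y) ∩ (openConn b y ∪ openConn c y)) _ from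
    (((((oc a b c y 0 2 rfl rfl)).union (oc a b c y 1 2 rfl rfl))).inter (((oc a b c y 0 3 rfl rfl)).union (oc a b c y 2 3 rfl rfl))).inter (((oc a b c y 1 3 rfl rfl)).union (oc a b c y 2 3 rfl rfl)))]
  simp (config := {decide := true}) only [ite_true, ite_false]; ring

/-- Dictionary entry: the event `(openConn a y ∪ openConn c y) ∩ (openConn b y ∪ openConn c y)` as a sum of four-point cells. [this work] -/
theorem d51 : (prodBernoulli w).real ((openConn a y ∪ openConn c y) ∩ (openConn b y ∪ openConn c y)) =
    cell w a b c y 1 + cell w a b c y 7 + cell w a b c y 10 + cell w a b c y 11 + cell w a b c y 12 + cell w a b c y 14 := by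
  rw [measureReal_eq_cellSum w a b c y (show HasPattern (quad a b c y) ((openConn a y ∪ openConn c y) ∩ (openConn b y ∪ openConn c y)) _ from
    ((((oc a b c y 0 3 rfl rfl)).union (oc a b c y 2 3 rfl rfl))).inter (((oc a b c y 1 3 rfl rfl)).union (oc a b c y 2 3 rfl rfl)))]
  simp (config := {decide := true}) only [ite_true, ite_false]; ring

/-- Dictionary entry: the event `(openConn a c ∪ openConn b c) ∩ (openConn b y ∪ openConn c y)` as a sum of four-point cells. [this work] -/
theorem d52 : (prodBernoulli w).real ((openConn a c ∪ openConn b c) ∩ (openConn b y ∪ openConn c y)) =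
    cell w a b c y 7 + cell w a b c y 9 + cell w a b c y 10 + cell w a b c y 14 := by
  rw [measureReal_eq_cellSum w a b c y (show HasPattern (quad a b c y) ((openConn a c ∪ openConn b c) ∩ (openConn b y ∪ openConn c y)) _ from
    ((((oc a b c y 0 2 rfl rfl)).union (oc a b c y 1 2 rfl rfl))).inter (((oc a b c y 1 3 rfl rfl)).union (oc a b c y 2 3 rfl rfl)))]
  simp (config := {decide := true}) only [ite_true, ite_false]; ring

/-- Dictionary entry: the event `openConn a b ∩ openConn a c ∩ openConn b y` as a sum of four-point cells. [this work] -/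
theorem d53 : (prodBernoulli w).real (openConn a b ∩ openConn a c ∩ openConn b y) =
    cell w a b c y 14 := by
  rw [measureReal_eq_cellSum w a b c y (show HasPattern (quad a b c y) (openConn a b ∩ openConn a c ∩ openConn b y) _ from
    (((oc a b c y 0 1 rfl rfl)).inter (oc a b c y 0 2 rfl rfl)).inter (oc a b c y 1 3 rfl rfl))]
  simp (config := {decide := true}) only [ite_true, ite_false]; ring

/-- Dictionary entry: the event `openConn a c ∩ openConn b y` as a sum of four-point cells. [this work] -/
theorem d54 : (prodBernoulli w).real (openConn a c ∩ openConn b y) =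
    cell w a b c y 9 + cell w a b c y 14 := by
  rw [measureReal_eq_cellSum w a b c y (show HasPattern (quad a b c y) (openConn a c ∩ openConn b y) _ from
    ((oc a b c y 0 2 rfl rfl)).inter (oc a b c y 1 3 rfl rfl))]
  simp (config := {decide := true}) only [ite_true, ite_false]; ring

/-- Dictionary entry: the event `openConn a b ∩ openConn b y` as a sum of four-point cells. [this work] -/
theorem d55 : (prodBernoulli w).real (openConn a b ∩ openConn b y) =
    cell w a b c y 12 + cell w a b c y 14 := by
  rw [measureReal_eq_cellSum w a b c y (show HasPattern (quad a b c y) (openConn a b ∩ openConn b y) _ from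
    ((oc a b c y 0 1 rfl rfl)).inter (oc a b c y 1 3 rfl rfl))]
  simp (config := {decide := true}) only [ite_true, ite_false]; ring

end IncDict

end SwitchRelax

end Summit.CriticalPhenomena.PercolationContinuityZ3.Theorems

end
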